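import Literature.Probability.RandomPlanarGeometry.SAWStripTMInvAdv2
import HarnessLib

/-!
# The invariant of the enriched strip transfer matrix, IV: `joinH` preserves it (soundness, part 8)

Topic `Literature/Probability/RandomPlanarGeometry` (soundness of `SAWStripTM.lean`, part 8;
continues `SAWStripTMInvAdv2.lean`). The horizontal micro-step: no edge; a new two-cell strand
(`empty`/`empty`); extension of a strand by the fresh left or right cell (`empty`/`stop`,
`stop`/`empty`); and the join of two different strands (`stop`/`stop`), with the retargeting of
the far ends. The frontier does not move during `joinH`, which keeps the bookkeeping lighter than
for `advance`.

## References

* I. Jensen, J. Phys. A 37 (2004) 11521–11529, §2.1.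
* D. E. Knuth, TAOCP 4A (2011), §7.1.4.
-/

namespace Literature.Probability.RandomPlanarGeometry.SAW

namespace StripTM

variable {l r0 : ℕ} {cs : List Bool} {u : ℕ} {σ σ' : State} {S : List (List XCell)}

/-! ### Lookups -/

/-- Lookups after `retarget`. [folklore] -/
theorem getElem?_retarget (L : List Code) (m m' : Mate) (k : ℕ) :
    (retarget L m m')[k]? =
      match m with
      | .col j => if j = k then (if j < L.length then some (.stop m') else none) else L[k]?
      | _ => L[k]? := by
  cases m with
  | col j => simp only [retarget]; rw [List.getElem?_set]
  | src => rfl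
  | snk => rfl

/-- Length after `retarget`. [folklore] -/
@[simp] theorem length_retarget (L : List Code) (m m' : Mate) : (retarget L m m').length = L.length := by
  cases m <;> simp [retarget]

/-- Lookups after `bump`. [folklore] -/
theorem getElem?_bump (G : List ℕ) (i k : ℕ) :
    (bump G i)[k]? = if i = k then (G[k]?).map (fun g => min 2 (g + 1)) else G[k]? := by
  rw [bump, List.getElem?_modify]
  split_ifs with h <;> cases G[k]? <;> rfl

/-- Length after `bump`. [folklore] -/
@[simp] theorem length_bump (G : List ℕ) (i : ℕ) : (bump G i).length = G.length := by
  simp [bump]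

/-! ### Frame facts at an odd micro-step -/

/-- At `joinH` the mates keep their meaning. [folklore] -/
theorem mateCell_succ_odd (hu : u % 2 = 1) {m : Mate} (hm : ∀ j, m = .col j → j < l) :
    mateCell l (u + 1) m = mateCell l u m := by
  cases m with
  | col j => exact front_succ_odd hu (hm j rfl)
  | src => rfl
  | snk => rfl

/-- The current cell is swept at an odd micro-time. [folklore] -/
theorem processed_cellOf_odd (hu : u % 2 = 1) (hl : 0 < l) : Processed l u (cellOf l (u / 2)) := by
  refine ⟨Nat.le_add_left 1 _, Nat.mod_lt _ hl, ?_⟩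
  have := (idx_eq_iff (l := l) (t := u / 2) hl (Nat.mod_lt _ hl) (Nat.le_add_left 1 _)).2 ⟨rfl, rfl⟩
  rw [this]; omega

/-- The left neighbour is swept at an odd micro-time (when it exists). [folklore] -/
theorem processed_leftOf_odd (hu : u % 2 = 1) (hl : 0 < l) (hc : 1 ≤ u / 2 % l) :
    Processed l u (leftOf l (u / 2)) := by
  have hlt : u / 2 % l < l := Nat.mod_lt _ hl
  refine ⟨Nat.le_add_left 1 _, by omega, ?_⟩
  have := (idx_eq_iff (l := l) (t := u / 2) hl hlt (Nat.le_add_left 1 _)).2 ⟨rfl, rfl⟩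
  simp only [Nat.add_sub_cancel] at this ⊢
  omega

/-- The horizontal edge of the current cell. [folklore] -/
theorem adj_leftOf_cellOf {t : ℕ} (hc : 1 ≤ t % l) : Adj l r0 (leftOf l t) (cellOf l t) := by
  simp only [Adj, leftOf, cellOf]; right; exact ⟨trivial, Or.inl (by omega)⟩

/-- The left neighbour is not the current cell. [folklore] -/
theorem leftOf_ne_cellOf {t : ℕ} (hc : 1 ≤ t % l) : leftOf l t ≠ cellOf l t := by
  simp only [leftOf, cellOf, ne_eq, XCell.cell.injEq, and_true]; omega

/-- The source time does not change across an odd micro-step. [folklore] -/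
theorem src_time_succ_odd (hu : u % 2 = 1) : 2 * (r0 * l) + 1 ≤ u + 1 ↔ 2 * (r0 * l) + 1 ≤ u := by
  omega

/-- The old end pairs keep their coded description across `joinH` away from changed columns.
[folklore] -/
theorem Inv.ends_reindex_odd (hI : Inv l r0 cs u σ S) (hu : u % 2 = 1) {a b : XCell} (ha : a.IsReal) :
    (a, b) ∈ endPairs S ↔ ∃ k < l, ∃ m, σ.slots[k]? = some (Code.stop m) ∧ a = front l (u + 1) k ∧
      b = mateCell l (u + 1) m := by
  rw [hI.ends a b ha]
  constructor
  · rintro ⟨k, hk, m, hkm, rfl, rfl⟩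
    exact ⟨k, hk, m, hkm, (front_succ_odd hu hk).symm,
      (mateCell_succ_odd hu (fun j hj => hI.mate_lt k j (hj ▸ hkm))).symm⟩
  · rintro ⟨k, hk, m, hkm, rfl, rfl⟩
    exact ⟨k, hk, m, hkm, front_succ_odd hu hk, mateCell_succ_odd hu (fun j hj => hI.mate_lt k j (hj ▸ hkm))⟩

/-! ### No edge -/

/-- **Case no horizontal edge.** [cite: Jensen2004SAWLowerBounds, §2.1] -/
theorem inv_joinH_false (hu : u % 2 = 1) (hI : Inv l r0 cs u σ S)
    (hcs : cs.getD u false = false) (he : joinH l (u / 2) σ false = .next σ') :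
    Inv l r0 cs (u + 1) σ' (gJoinH l (u / 2) σ S false) := by
  have hσ : σ' = σ := by simp [joinH] at he; exact he.symm
  subst hσ
  have hg : gJoinH l (u / 2) σ' S false = S := by simp [gJoinH]
  rw [hg]
  refine ⟨hI.len_slots, hI.len_gaps, hI.mate_lt, hI.wf, hI.two_le, ?_, ?_, ?_, ?_, ?_, ?_, ?_, ?_⟩
  · intro x hx; exact (processed_succ_odd hu x).2 (hI.processed x hx)
  · intro a b ha; exact hI.ends_reindex_odd hu ha
  · intro k hk hk'; rw [front_succ_odd hu hk]; exact hI.empty k hk hk'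
  · intro k hk c' hk'; rw [front_succ_odd hu hk] at hk'; exact hI.dummy k hk c' hk'
  · rw [hI.vsrc_mem, src_time_succ_odd hu]
  · exact hI.vsnk_mem
  · intro p; rw [Nat.exists_lt_succ_right, hcs, hI.pairs_iff]; simp
  · intro k hk
    rw [hI.gaps_eq k hk, hcount_succ_of_odd hu, hcs]
    simp

/-! ### A new two-cell strand -/

/-- `joinH`, case `empty`/`empty`/edge. [folklore] -/
theorem joinH_empty_empty {t : ℕ} {σ : State} (hc : t % l ≠ 0) (ha : σ.slots[t % l - 1]? = some Code.empty)
    (hb : σ.slots[t % l]? = some Code.empty) :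
    joinH l t σ true = .next { σ with
      slots := (σ.slots.set (t % l - 1) (.stop (.col (t % l)))).set (t % l) (.stop (.col (t % l - 1)))
      gaps := bump σ.gaps (t % l - 1) } := by
  simp only [joinH, hc, ha, hb, Option.getD_some]
  rfl

/-- `gJoinH`, case `empty`/`empty`/edge. [folklore] -/
theorem gJoinH_empty_empty {t : ℕ} {σ : State} (S : List (List XCell))
    (ha : σ.slots[t % l - 1]? = some Code.empty) (hb : σ.slots[t % l]? = some Code.empty) :
    gJoinH l t σ S true = merge (S ++ [[leftOf l t]] ++ [[cellOf l t]]) (leftOf l t) (cellOf l t) := by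
  simp only [gJoinH, ha, hb, Option.getD_some]
  rfl

/-- **Case `empty`/`empty`/edge of `joinH`**: a new strand on the two fresh cells.
[cite: Jensen2004SAWLowerBounds, §2.1] -/
theorem inv_joinH_empty_empty (hl : 2 ≤ l) (hu : u % 2 = 1) (hI : Inv l r0 cs u σ S)
    (hc1 : 1 ≤ u / 2 % l) (ha : σ.slots[u / 2 % l - 1]? = some Code.empty)
    (hb : σ.slots[u / 2 % l]? = some Code.empty) (hcs : cs.getD u false = true)
    (he : joinH l (u / 2) σ true = .next σ') :
    Inv l r0 cs (u + 1) σ' (gJoinH l (u / 2) σ S true) := by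
  have hl0 : 0 < l := by omega
  have hc : u / 2 % l < l := Nat.mod_lt _ hl0
  have hcm : u / 2 % l - 1 < l := by omega
  have hcs' : u / 2 % l < σ.slots.length := by rw [hI.len_slots]; exact hc
  have hcm' : u / 2 % l - 1 < σ.slots.length := by rw [hI.len_slots]; exact hcm
  have hne : u / 2 % l - 1 ≠ u / 2 % l := by omega
  rw [joinH_empty_empty (by omega) ha hb] at he
  have hsl : σ'.slots = (σ.slots.set (u / 2 % l - 1) (.stop (.col (u / 2 % l)))).set (u / 2 % l)
      (.stop (.col (u / 2 % l - 1))) := by cases he; rfl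
  have hga : σ'.gaps = bump σ.gaps (u / 2 % l - 1) := by cases he; rfl
  have hsi : σ'.sink = σ.sink := by cases he; rfl
  rw [gJoinH_empty_empty S ha hb]
  have hvf : cellOf l (u / 2) = front l u (u / 2 % l) := cellOf_eq_front hu
  have hlf : leftOf l (u / 2) = front l u (u / 2 % l - 1) := leftOf_eq_front hu
  have hvnot : cellOf l (u / 2) ∉ cells S := hvf ▸ hI.empty _ hc hb
  have hlnot : leftOf l (u / 2) ∉ cells S := hlf ▸ hI.empty _ hcm ha
  have hA := adj_symm l r0
  obtain ⟨hW2, h2le2, hcells2, hpairs2, hends2⟩ :=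
    new2_spec hI.wf hA hI.two_le hlnot hvnot (leftOf_ne_cellOf hc1) (adj_leftOf_cellOf hc1)
  refine ⟨?_, ?_, ?_, hW2, h2le2, ?_, ?_, ?_, ?_, ?_, ?_, ?_, ?_⟩
  · rw [hsl, List.length_set, List.length_set, hI.len_slots]
  · rw [hga, length_bump, hI.len_gaps]
  · intro k j h
    rw [hsl, getElem?_set_set hcm' hcs' hne] at h
    split_ifs at h with h1 h2
    · cases h; exact hcm
    · cases h; exact hc
    · exact hI.mate_lt k j h
  · intro x hx
    rw [hcells2] at hx; simp only [Finset.mem_insert] at hx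
    rcases hx with rfl | rfl | hx
    · exact (processed_succ_odd hu _).2 (processed_leftOf_odd hu hl0 hc1)
    · exact (processed_succ_odd hu _).2 (processed_cellOf_odd hu hl0)
    · exact (processed_succ_odd hu _).2 (hI.processed x hx)
  · intro a b ha'
    rw [hends2, hI.ends_reindex_odd hu ha', hsl]
    constructor
    · rintro (⟨k, hk, m, hkm, rfl, rfl⟩ | ⟨rfl, rfl⟩ | ⟨rfl, rfl⟩)
      · refine ⟨k, hk, m, ?_, rfl, rfl⟩
        rw [getElem?_set_set hcm' hcs' hne]
        rw [if_neg, if_neg]; exact hkm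
        · rintro rfl; rw [ha] at hkm; simp at hkm
        · rintro rfl; rw [hb] at hkm; simp at hkm
      · refine ⟨_, hcm, _, by rw [getElem?_set_set hcm' hcs' hne, if_neg hne, if_pos rfl], ?_, ?_⟩
        · rw [hlf, front_succ_odd hu hcm]
        · simp only [mateCell]; rw [hvf, front_succ_odd hu hc]
      · refine ⟨_, hc, _, by rw [getElem?_set_set hcm' hcs' hne, if_pos rfl], ?_, ?_⟩
        · rw [hvf, front_succ_odd hu hc]
        · simp only [mateCell]; rw [hlf, front_succ_odd hu hcm]
    · rintro ⟨k, hk, m, hkm, rfl, rfl⟩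
      rw [getElem?_set_set hcm' hcs' hne] at hkm
      split_ifs at hkm with h1 h2
      · subst h1; cases hkm
        right; right; simp only [mateCell]
        rw [front_succ_odd hu hc, front_succ_odd hu hcm, hvf, hlf]; exact ⟨rfl, rfl⟩
      · subst h2; cases hkm
        right; left; simp only [mateCell]
        rw [front_succ_odd hu hc, front_succ_odd hu hcm, hvf, hlf]; exact ⟨rfl, rfl⟩
      · exact Or.inl ⟨k, hk, m, hkm, rfl, rfl⟩
  · intro k hk hk'
    rw [hsl, getElem?_set_set hcm' hcs' hne] at hk'
    split_ifs at hk' with h1 h2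
    · simp at hk'
    · simp at hk'
    · rw [front_succ_odd hu hk, hcells2]
      simp only [Finset.mem_insert, not_or]
      refine ⟨?_, ?_, hI.empty k hk hk'⟩
      · rw [hlf]; intro e; exact h2 (front_inj e)
      · rw [hvf]; intro e; exact h1 (front_inj e)
  · intro k hk c' hk'
    rw [hsl, getElem?_set_set hcm' hcs' hne]
    rw [front_succ_odd hu hk] at hk'
    split_ifs with h1 h2
    · exfalso; subst h1; rw [← hvf, cellOf] at hk'; cases hk'
    · exfalso; subst h2; rw [← hlf, leftOf] at hk'; cases hk'
    · exact hI.dummy k hk c' hk'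
  · rw [hcells2]; simp only [Finset.mem_insert, leftOf, cellOf, reduceCtorEq, false_or]
    rw [hI.vsrc_mem, src_time_succ_odd hu]
  · rw [hcells2, hsi]; simp only [Finset.mem_insert, leftOf, cellOf, reduceCtorEq, false_or]; exact hI.vsnk_mem
  · intro p
    rw [hpairs2, Nat.exists_lt_succ_right, potEdge_of_odd hu, hcs, Finset.mem_insert]
    simp only [true_and]
    constructor
    · rintro ⟨rfl | hp, hreal⟩
      · exact Or.inr rfl
      · exact Or.inl ((hI.pairs_iff p).1 ⟨hp, hreal⟩)
    · rintro (h | rfl)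
      · obtain ⟨hp, hreal⟩ := (hI.pairs_iff p).2 h; exact ⟨Or.inr hp, hreal⟩
      · exact ⟨Or.inl rfl, Sym2.ball.2 ⟨by simp [leftOf, XCell.IsReal], by simp [cellOf, XCell.IsReal]⟩⟩
  · intro k hk
    rw [hga, getElem?_bump, hcount_succ_of_odd hu, hcs, hI.gaps_eq k hk]
    by_cases hk1 : u / 2 % l - 1 = k
    · rw [if_pos hk1, if_pos ⟨by omega, rfl⟩]; simp only [Option.map_some]
      congr 1; omega
    · rw [if_neg hk1, if_neg (by rintro ⟨h, -⟩; omega)]; rfl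

end StripTM

end Literature.Probability.RandomPlanarGeometry.SAW
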